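/-
Copyright (c) 2026 the pub-hodgecm-mathlib formalisation cell (harness21).  Prover seat hodgecm-mathlib-K2E1-p12 (g7), Track B ∕ R90-TF, h413 = `stmt-HodgeConjecture-24833`,
R90-TF section S8 «ContSpec-n½», socket (E) :276, E1-PLANCHEREL BODY — the BOX-BOUND letter of ★ PB-2d `K2E1PseudoEisensteinEntryLettersOfExports` (S8 dealer R90-CS-plan (g4)
S8-R280 (3) ∕ S8-R305): the strip bound `hB` of the vector contour shift from the VECTOR MAASS–SELBERG INEQUALITY per generator (★ `K2E1ScatteringBoundMaassSelbergU2`'s ζ-free real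
algebra ∘ ★ `exists_coordBound_of_linearIndependent` ∘ ★ `entry_hB_of_boxBounds`).  Pure real algebra + linear algebra, on letters.
-/
import Summits.HodgeConjecture.HodgeConjecture.Theorems.K2E1OperatorUnitaryAxisOfFEAxisGeneric   -- ★ exports row (this seat): `exists_coordBound_of_linearIndependent`; brings ★ PB-2d `entry_hB_of_boxBounds`
import Summits.HodgeConjecture.HodgeConjecture.Theorems.K2E1ScatteringBoundMaassSelbergU2        -- ★ T1 (K2E1 lineage): `exists_norm_le_of_maassSelberg_ineq` (rank parameter `ρ₀`, ζ-free)
import HarnessLib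

/-!
# BOX BOUND ⇐ VECTOR MAASS–SELBERG — `K2E1PseudoEisensteinStripBoundOfMaassSelberg`: the strip bound `hB` of ★ PB-2a′ from the vector Maass–Selberg inequality per generator
# (pure real algebra + linear algebra, on letters)

Track B ∕ R90-TF, crux h413 = `stmt-HodgeConjecture-24833`, route of record `HCCMUnconditional`; cell `hodgecm-mathlib`, R90-TF programme, section S8 «ContSpec-n½», socket (E)
(B ED. 7 :276): the E1-PLANCHEREL BODY at the τ-cut block; PB-2 chain ★.  THEOREMS ONLY (no `def`, no `instance`, no `notation`, no named-fact hypothesis, no `sorry`; default heartbeats);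
lane `--supports stmt-HodgeConjecture-24833 --as helper` (count-neutral).  No automorphic object.  CLOSES NO SOCKET.

THE MATHEMATICS ([MoeglinWaldspurger1995, IV.2.3–IV.2.4, IV.3.12]; [Langlands1976, §7]; [Iwaniec2002, §6.3, §7 p. 103]).  ★ PB-2d reduced the strip bound `hB` of the vector contour shift
(★ PB-2a′) to PER-COORDINATE BOX BOUNDS `‖qc_j^{(a)}(z)‖ ≤ B_q` on `{κ < Re z ≤ σ₀, |Im z| ≥ 1}`.  For the continued intertwining operator these come from the MAASS–SELBERG RELATION of
the truncated Eisenstein series continued to the strip: at `z = κ + x + it`, `x > 0`, `t ≠ 0`, truncation parameter `T₀ ≥ 1`,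
`0 ≤ ‖Λ^{T₀}E(φ, z)‖² = ‖φ‖²·T₀^{2x}∕(2x) − ‖M(z)φ‖²·T₀^{−2x}∕(2x) + (oscillatory term, |·| ≤ ‖M(z)φ‖·‖φ‖∕|t|)`, whence the VECTOR MS INEQUALITY **(hMSv)**
`‖M(z)φ‖² ≤ ‖φ‖²·T₀^{4x} + 2x·‖M(z)φ‖·‖φ‖·T₀^{2x}∕|t|` — the letter this file consumes, per generator `φ_a`, in EXACTLY the shape of ★ `exists_norm_le_of_maassSelberg_ineq`'s `hMS` (scalar
case `a = ‖φ‖²`; the MS road owns its proof on the strip).  From it (§1, ★'s ζ-free real algebra `s² ≤ A + Bs ⇒ s ≤ B + √A` applied to `s = ‖M(z)φ‖∕‖φ‖`): `‖M(z)φ_a‖ ≤ B·‖φ_a‖`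
uniformly on the strip; with the COORDINATE FORMULA `M(z)φ_a = Σ_j qc_j^{(a)}(z)•φ'_j` on linearly independent columns (★ exports), ★ `exists_coordBound_of_linearIndependent` turns this into
per-coordinate box bounds (§2), and ★ PB-2d `entry_hB_of_boxBounds` into ★ PB-2a′'s `hB` for the export-shaped entries `Σ_j qc_j^{(a)}(z)·G_{abj}` (§2 HEAD **`entry_hB_of_vectorMS`**).
* §1 **`norm_map_le_of_vectorMS`** (one constant `B`, uniform over all vectors satisfying (hMSv)).
* §2 `boxBounds_of_vectorMS`, HEAD **`entry_hB_of_vectorMS`**.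
HONEST LABEL: HC_CM is proved only modulo the 7 printed citations (2 remaining named inputs: hLiu418 = `stmt-HodgeConjecture-24832`, h413 = `stmt-HodgeConjecture-24833`) until rung 0
closes; this file asserts no named fact, closes no socket; count-neutral; (hMSv) — the vector Maass–Selberg inequality for the CONTINUED family on the strip — is the HYPOTHESIS (MS road, L),
named here in its exact shape so that nobody books it as paid.

## References
* [MoeglinWaldspurger1995] C. Mœglin, J.-L. Waldspurger, *Spectral decomposition and Eisenstein series* (1995), IV.2.3–IV.2.4, IV.3.12.
* [Langlands1976] R. P. Langlands, *On the Functional Equations Satisfied by Eisenstein Series*, LNM 544 (1976), §7.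
* [Iwaniec2002] H. Iwaniec, *Spectral Methods of Automorphic Forms* (2nd ed., 2002), §6.3, §7 (p. 103).
-/

set_option autoImplicit false
set_option linter.dupNamespace false  -- the mandated namespace repeats the summit's segment (`HodgeConjecture.HodgeConjecture`)

noncomputable section

open Set Filter Topology Complex
open scoped ComplexConjugate InnerProductSpace BigOperators
open Summit.HodgeConjecture.HodgeConjecture.Cruxes.H413.K2E1ScatteringBoundMaassSelbergU2 (le_add_sqrt_of_sq_le)
open Summit.HodgeConjecture.HodgeConjecture.Cruxes.H413.K2E1OperatorUnitaryAxisOfFEAxisGeneric (exists_coordBound_of_linearIndependent)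
open Summit.HodgeConjecture.HodgeConjecture.Cruxes.H413.K2E1PseudoEisensteinEntryLettersOfExports (entry_hB_of_boxBounds)

namespace Summit.HodgeConjecture.HodgeConjecture.Cruxes.H413.K2E1PseudoEisensteinStripBoundOfMaassSelberg

variable {V : Type*} [NormedAddCommGroup V] [InnerProductSpace ℂ V]

/-! ## §1 `‖M(z)φ‖ ≤ B·‖φ‖` on the strip from the vector Maass–Selberg inequality -/

omit [InnerProductSpace ℂ V] in
/-- **THE VECTOR MS INEQUALITY BOUNDS `M(z)φ` ON THE STRIP**: if on `{κ < Re z ≤ σ₀, |Im z| ≥ 1}` (`T₀ ≥ 1`)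
**(hMSv)** `‖M(z)φ‖² ≤ ‖φ‖²·T₀^{4(Re z−κ)} + 2(Re z−κ)·‖M(z)φ‖·‖φ‖·T₀^{2(Re z−κ)}∕|Im z|`, then `‖M(z)φ‖ ≤ B·‖φ‖` there with ★'s `B = 2(σ₀−κ)T₀^{2(σ₀−κ)} + T₀^{2(σ₀−κ)}`
(★ `exists_norm_le_of_maassSelberg_ineq`'s two real-algebra steps at `ρ₀ := κ` — ★ `le_add_sqrt_of_sq_le` + monotonicity — run on `z ↦ ‖M(z)φ‖∕‖φ‖` with the constant kept uniform in `φ`; `φ = 0` is trivial). [cite: MoeglinWaldspurger1995, IV.2.3, IV.3.12] [cite: Langlands1976, §7] -/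
theorem norm_map_le_of_vectorMS (M : ℂ → V → V) (hM0 : ∀ z, M z 0 = 0) {κ σ₀ T₀ : ℝ} (hσ₀ : κ < σ₀) (hT₀ : 1 ≤ T₀) :
    ∃ B : ℝ, 0 ≤ B ∧ ∀ φ : V, (∀ z : ℂ, κ < z.re → z.re ≤ σ₀ → 1 ≤ |z.im| →
        ‖M z φ‖ ^ 2 ≤ ‖φ‖ ^ 2 * T₀ ^ (4 * (z.re - κ)) + 2 * (z.re - κ) * ‖M z φ‖ * ‖φ‖ * T₀ ^ (2 * (z.re - κ)) / |z.im|) →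
      ∀ z : ℂ, κ < z.re → z.re ≤ σ₀ → 1 ≤ |z.im| → ‖M z φ‖ ≤ B * ‖φ‖ := by
  -- ★'s explicit constant is the uniform `B`
  have hT₀0 : 0 < T₀ := zero_lt_one.trans_le hT₀
  set B : ℝ := 2 * (σ₀ - κ) * T₀ ^ (2 * (σ₀ - κ)) + T₀ ^ (2 * (σ₀ - κ)) with hB
  have hB0 : 0 ≤ B := add_nonneg (mul_nonneg (by linarith) (Real.rpow_nonneg hT₀0.le _)) (Real.rpow_nonneg hT₀0.le _)
  refine ⟨B, hB0, fun φ hMSv z hz₁ hz₂ ht => ?_⟩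
  by_cases hφ : φ = 0
  · subst hφ; rw [hM0, norm_zero, mul_zero]
  have hφpos : 0 < ‖φ‖ := norm_pos_iff.2 hφ
  -- the normalised scalar `c z := ‖M z φ‖ ∕ ‖φ‖` satisfies ★'s `hMS`
  set c : ℂ → ℂ := fun z => (((‖M z φ‖ / ‖φ‖ : ℝ)) : ℂ) with hc
  have hcn : ∀ z, ‖c z‖ = ‖M z φ‖ / ‖φ‖ := fun z => by
    rw [hc]; dsimp only; rw [Complex.norm_real, Real.norm_eq_abs, abs_of_nonneg (div_nonneg (norm_nonneg _) hφpos.le)]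
  have hMS : ∀ z : ℂ, κ < z.re → z.re ≤ σ₀ → 1 ≤ |z.im| → ‖c z‖ ^ 2 ≤ T₀ ^ (4 * (z.re - κ)) + 2 * (z.re - κ) * ‖c z‖ * T₀ ^ (2 * (z.re - κ)) / |z.im| := by
    intro w hw₁ hw₂ hwt
    have h := hMSv w hw₁ hw₂ hwt
    have hφ2 : 0 < ‖φ‖ ^ 2 := by positivity
    rw [hcn w, div_pow]
    rw [div_le_iff₀ hφ2]
    have e : (T₀ ^ (4 * (w.re - κ)) + 2 * (w.re - κ) * (‖M w φ‖ / ‖φ‖) * T₀ ^ (2 * (w.re - κ)) / |w.im|) * ‖φ‖ ^ 2 =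
        ‖φ‖ ^ 2 * T₀ ^ (4 * (w.re - κ)) + 2 * (w.re - κ) * ‖M w φ‖ * ‖φ‖ * T₀ ^ (2 * (w.re - κ)) / |w.im| := by
      field_simp
    rw [e]
    exact h
  -- ★ `exists_norm_le_of_maassSelberg_ineq`'s witness is this explicit `B`; to keep it UNIFORM in `φ` we re-run its two real-algebra steps at the point
  set P : ℝ := T₀ ^ (2 * (z.re - κ)) with hPdef
  have hP : 0 ≤ P := Real.rpow_nonneg hT₀0.le _
  have h4 : T₀ ^ (4 * (z.re - κ)) = P * P := by rw [hPdef, ← Real.rpow_add hT₀0]; congr 1; ring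
  have hdrop : 2 * (z.re - κ) * ‖c z‖ * T₀ ^ (2 * (z.re - κ)) / |z.im| ≤ (2 * (z.re - κ) * P) * ‖c z‖ := by
    rw [← hPdef]
    calc 2 * (z.re - κ) * ‖c z‖ * P / |z.im| ≤ 2 * (z.re - κ) * ‖c z‖ * P := div_le_self (by positivity) ht
      _ = (2 * (z.re - κ) * P) * ‖c z‖ := by ring
  have hsq : ‖c z‖ ^ 2 ≤ P * P + (2 * (z.re - κ) * P) * ‖c z‖ := by
    have h := hMS z hz₁ hz₂ ht
    rw [h4] at h
    linarith
  have h1 := le_add_sqrt_of_sq_le (mul_nonneg hP hP) (by positivity) hsq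
  rw [Real.sqrt_mul_self hP] at h1
  have hPP : P ≤ T₀ ^ (2 * (σ₀ - κ)) := Real.rpow_le_rpow_of_exponent_le hT₀ (by linarith)
  have hcB : ‖c z‖ ≤ B :=
    calc ‖c z‖ ≤ 2 * (z.re - κ) * P + P := h1
      _ ≤ 2 * (σ₀ - κ) * T₀ ^ (2 * (σ₀ - κ)) + T₀ ^ (2 * (σ₀ - κ)) := add_le_add (mul_le_mul (by linarith) hPP hP (by linarith)) hPP
  rw [hcn z, div_le_iff₀ hφpos] at hcB
  exact hcB

/-! ## §2 Per-coordinate box bounds and ★ PB-2a′'s `hB` -/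

/-- **PER-COORDINATE BOX BOUNDS FROM THE VECTOR MS INEQUALITY**: with the coordinate formula **(hM)** `M(z)φ_a = Σ_j qc_j^{(a)}(z)•φ'_j` on the strip, linearly independent columns `φ'`, and
**(hMSv)** for every generator `φ_a`: `∃ B_q, ‖qc_j^{(a)}(z)‖ ≤ B_q` on `{κ < Re z ≤ σ₀, |Im z| ≥ 1}` — the `hbox` letter of ★ PB-2d `entry_hB_of_boxBounds` (★ `exists_coordBound_of_linearIndependent`
∘ §1). [cite: MoeglinWaldspurger1995, IV.2.3, IV.3.12] [cite: Langlands1976, §7] -/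
theorem boxBounds_of_vectorMS {ι α : Type*} [Fintype ι] [Fintype α] {φ' : ι → V} (hli : LinearIndependent ℂ φ') (φ : α → V) (qc : α → ι → ℂ → ℂ)
    (M : ℂ → V → V) (hM0 : ∀ z, M z 0 = 0) {κ σ₀ T₀ : ℝ} (hσ₀ : κ < σ₀) (hT₀ : 1 ≤ T₀)
    (hM : ∀ a (z : ℂ), κ < z.re → z.re ≤ σ₀ → 1 ≤ |z.im| → M z (φ a) = ∑ j, qc a j z • φ' j)
    (hMSv : ∀ a (z : ℂ), κ < z.re → z.re ≤ σ₀ → 1 ≤ |z.im| →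
      ‖M z (φ a)‖ ^ 2 ≤ ‖φ a‖ ^ 2 * T₀ ^ (4 * (z.re - κ)) + 2 * (z.re - κ) * ‖M z (φ a)‖ * ‖φ a‖ * T₀ ^ (2 * (z.re - κ)) / |z.im|) :
    ∃ Bq : ℝ, ∀ a j (z : ℂ), κ < z.re → z.re ≤ σ₀ → 1 ≤ |z.im| → ‖qc a j z‖ ≤ Bq := by
  obtain ⟨B, hB0, hB⟩ := norm_map_le_of_vectorMS M hM0 hσ₀ hT₀
  obtain ⟨K, hK0, hK⟩ := exists_coordBound_of_linearIndependent hli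
  refine ⟨K * (B * ∑ a, ‖φ a‖), fun a j z hz₁ hz₂ ht => ?_⟩
  have h1 := hK (fun i => qc a i z) j
  rw [← hM a z hz₁ hz₂ ht] at h1
  have h2 : ‖M z (φ a)‖ ≤ B * ∑ a, ‖φ a‖ :=
    (hB (φ a) (hMSv a) z hz₁ hz₂ ht).trans (mul_le_mul_of_nonneg_left (Finset.single_le_sum (fun a _ => norm_nonneg (φ a)) (Finset.mem_univ a)) hB0)
  exact h1.trans (mul_le_mul_of_nonneg_left h2 hK0)

/-- **HEAD — ★ PB-2a′'s `hB` FROM THE VECTOR MAASS–SELBERG INEQUALITY.**  Data: linearly independent columns `φ'_j`, generators `φ_a`, continued coordinates `qc_j^{(a)}` with the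
coordinate formula **(hM)** on the strip, constant Gram entries `G_{abj}`, and per generator the VECTOR MS INEQUALITY **(hMSv)** on `{κ < Re z ≤ σ₀, |Im z| ≥ 1}` (`T₀ ≥ 1`).  CONCLUSION:
`∃ B, ∀ a b z, κ < Re z → Re z ≤ σ₀ → 1 ≤ |Im z| → ‖Σ_j qc_j^{(a)}(z)·G_{abj}‖ ≤ B` — the `hB` binder of ★ `pseudoEisenstein_contourShift_vector_axis_of_letters` ∕ `…_cm_three` for export-shaped
entries (§2 box bounds ∘ ★ PB-2d `entry_hB_of_boxBounds`).  ζ-free (no `L`-function growth, no Stirling, no Phragmén–Lindelöf). [cite: MoeglinWaldspurger1995, IV.2.3, IV.3.12] [cite: Langlands1976, §7] -/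
theorem entry_hB_of_vectorMS {ι α β : Type*} [Fintype ι] [Fintype α] [Fintype β] {φ' : ι → V} (hli : LinearIndependent ℂ φ') (φ : α → V) (qc : α → ι → ℂ → ℂ)
    (G : α → β → ι → ℂ) (M : ℂ → V → V) (hM0 : ∀ z, M z 0 = 0) {κ σ₀ T₀ : ℝ} (hσ₀ : κ < σ₀) (hT₀ : 1 ≤ T₀)
    (hM : ∀ a (z : ℂ), κ < z.re → z.re ≤ σ₀ → 1 ≤ |z.im| → M z (φ a) = ∑ j, qc a j z • φ' j)
    (hMSv : ∀ a (z : ℂ), κ < z.re → z.re ≤ σ₀ → 1 ≤ |z.im| →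
      ‖M z (φ a)‖ ^ 2 ≤ ‖φ a‖ ^ 2 * T₀ ^ (4 * (z.re - κ)) + 2 * (z.re - κ) * ‖M z (φ a)‖ * ‖φ a‖ * T₀ ^ (2 * (z.re - κ)) / |z.im|) :
    ∃ B : ℝ, ∀ a b, ∀ z : ℂ, κ < z.re → z.re ≤ σ₀ → 1 ≤ |z.im| → ‖∑ j, qc a j z * G a b j‖ ≤ B := by
  obtain ⟨Bq, hBq⟩ := boxBounds_of_vectorMS hli φ qc M hM0 hσ₀ hT₀ hM hMSv
  exact entry_hB_of_boxBounds qc G hBq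

end Summit.HodgeConjecture.HodgeConjecture.Cruxes.H413.K2E1PseudoEisensteinStripBoundOfMaassSelberg

end
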